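import Summits.AtomisticToContinuum.BoseEinsteinCondensation.Theorems.BECInsertionCorrectorCorrectorClosureUvTransferFourier
import Summits.AtomisticToContinuum.BoseEinsteinCondensation.Theorems.BECInsertionCorrectorStaticResponseBoundTruncationMonotone
import HarnessLib

/-!
# Crux `CorrectorClosure` (stmt-AtomisticToContinuum-12058), line `healing-scale-kac-insertion` —
# registered stub `stub_uvTransfer` (part 2 of 2: the UV-transfer estimate)

Supports (does not close) stmt-AtomisticToContinuum-12058, route `BECInsertionCorrector`.
The registered stub `stub_uvTransfer` of the lead's skeleton
`Cruxes/CorrectorClosure/Lines/healing-scale-kac-insertion.lean` (v3), proved for EVERY measurable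
pair potential `v ≥ 0` (hard cores included): the Gaussian smoothing `e^{TΔ₀}` of the
`(N+1)`-body torus Feynman–Kac ground state `Φ₀` in the tagged coordinate only, at the healing time
`T = (N+1)/(16 E₀(N+1,L))`, keeps `B = ∫_cell (e^{TΔ₀}Φ₀)² ≥ 9/16` of the mass.

Proof (no kinetic energy of the eigenfunction is used; `Φ₀` is only measurable and `L²(cell)`):
`L^{-3(N+1)} B = ∑ₙ e^{-8π²T|n₀|²/L²}|ĉₙ(Φ₀)|²` (Parseval for `L²` data and the multiplier of the
tagged smoothing, part 1; if `e^{TΔ₀}Φ₀ ∉ L²(cell)` there is nothing to prove); Bose symmetry of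
`|ĉₙ(Φ₀)|²` (`configFourierCoeff_perm` of `BECInsertionCorrectorStaticResponseBoundTruncationMonotone`)
and AM–GM on the `N+1` blocks give `≥ ∑ₙ e^{-8π²t|n|²/L²}|ĉₙ(Φ₀)|² = L^{-3(N+1)} ‖e^{tΔ}Φ₀‖²_cell`,
`t = T/(N+1)` (multiplier of the free flow, part 1); Feynman–Kac domination
`|e^{tΔ}Φ₀| ≥ e^{-tH}Φ₀ = e^{-tE₀}Φ₀` pointwise (`exp_mul_le_norm_periodicHeatFlow_zero_pot`) gives
`‖e^{tΔ}Φ₀‖²_cell ≥ e^{-2tE₀} = e^{-1/8} ≥ 9/16`. Degenerate branch `T ≤ 0`: the smoothing is the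
identity and `B = 1`. Also here: the explicit kernel `(4πT)^{-3/2}e^{-|z|²/4T}` of the stub is the
product Gaussian density of variance `2T` (`gaussKernel_eq_prod`).
-/

noncomputable section

open MeasureTheory ProbabilityTheory Filter Matrix Complex UnitAddTorus
open scoped ENNReal NNReal BigOperators ComplexConjugate

namespace Summit.AtomisticToContinuum.BoseEinsteinCondensation.Theorems.CorrectorClosure.HealingScaleKacInsertion

open Literature.MathematicalPhysics.QuantumManyBody.BoseGas
open Literature.Probability.Process (preWienerMeasure brownian measurable_brownian)
open Summit.AtomisticToContinuum.BoseEinsteinCondensation.Cruxes.StaticResponseBound.UvThomsonForceWave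
  (configFourierCoeff_perm)

variable {N : ℕ} {L : ℝ}

/-! ### The explicit kernel of the stub -/

/-- The explicit tagged heat kernel `(4πT)^{-3/2} e^{-|z|²/4T}` is the product Gaussian density
of variance `2T`. [folklore] -/
theorem gaussKernel_eq_prod {T : ℝ} (hT : 0 < T) (z : Space) :
    ((4 * Real.pi * T) ^ (3 / 2 : ℝ))⁻¹ * Real.exp (-‖z‖ ^ 2 / (4 * T)) =
      ∏ k, gaussianPDFReal 0 (2 * T.toNNReal) (z k) := by
  simp only [gaussianPDFReal, NNReal.coe_mul, NNReal.coe_ofNat, Real.coe_toNNReal T hT.le,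
    sub_zero]
  rw [Finset.prod_mul_distrib, Finset.prod_const, Finset.card_univ, Fintype.card_fin,
    ← Real.exp_sum]
  congr 1
  · rw [inv_pow]
    congr 1
    rw [show 2 * Real.pi * (2 * T) = 4 * Real.pi * T by ring, Real.sqrt_eq_rpow,
      ← Real.rpow_natCast, ← Real.rpow_mul (by positivity)]
    norm_num
  · congr 1
    rw [EuclideanSpace.real_norm_sq_eq, neg_div, Finset.sum_div, ← Finset.sum_neg_distrib]
    refine Finset.sum_congr rfl fun k _ => ?_
    rw [neg_div]
    congr 1
    ring

/-- `(X₀ - z, X₁, …, X_N) = X + (-z) e₀` in `vecCons` form. [folklore] -/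
theorem vecCons_sub_vecTail (X : Config (N + 1)) (z : Space) :
    (vecCons (X 0 - z) (vecTail X) : Config (N + 1)) = X + Pi.single (0 : Fin (N + 1)) (-z) := by
  funext i
  refine Fin.cases ?_ (fun j => ?_) i
  · simp [sub_eq_add_neg]
  · simp [vecTail]

/-! ### Glue -/

/-- `L²` membership from a finite square lower integral. [folklore] -/
theorem memLp_two_of_lintegral_ne_top {α : Type*} [MeasurableSpace α] {μ : Measure α}
    {f : α → ℂ} (hf : AEStronglyMeasurable f μ) (h : ∫⁻ x, ‖f x‖ₑ ^ 2 ∂μ ≠ ⊤) : MemLp f 2 μ := by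
  refine ⟨hf, ?_⟩
  rw [eLpNorm_eq_lintegral_rpow_enorm_toReal two_ne_zero ENNReal.ofNat_ne_top]
  simp only [ENNReal.toReal_ofNat, ENNReal.rpow_two, one_div]
  exact ENNReal.rpow_lt_top_of_nonneg (by norm_num) h

/-- For `f ∈ L²`, `∫⁻ ‖f‖ₑ² = ofReal (∫ ‖f‖²)`. [folklore] -/
theorem lintegral_enorm_sq_eq_ofReal {α : Type*} [MeasurableSpace α] {μ : Measure α}
    {f : α → ℂ} (hf : MemLp f 2 μ) :
    ∫⁻ x, ‖f x‖ₑ ^ 2 ∂μ = ENNReal.ofReal (∫ x, ‖f x‖ ^ 2 ∂μ) := by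
  rw [ofReal_integral_eq_lintegral_ofReal ((memLp_two_iff_integrable_sq_norm hf.1).1 hf)
    (Eventually.of_forall fun x => by positivity)]
  refine lintegral_congr fun x => ?_
  rw [← ofReal_norm, ENNReal.ofReal_pow (norm_nonneg _)]

/-- The tagged smoothing of real data `Φ`, written as in the stub: the complex translation
average against the block Gaussian law is the real integral
`∫ (4πT)^{-3/2} e^{-|z|²/4T} Φ(X₀ - z, X₁, …) dz`. [folklore] -/
theorem integral_gaussian_translate_eq_ofReal (Φ : Config (N + 1) → ℝ) {T : ℝ} (hT : 0 < T)
    (X : Config (N + 1)) :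
    ∫ z, ((Φ (X + Pi.single (0 : Fin (N + 1)) (-z)) : ℝ) : ℂ)
        ∂(volume : Measure Space).withDensity (fun z : Space => ∏ k, gaussianPDF 0 (2 * T.toNNReal) (z k)) =
      ((∫ z : Space, ((4 * Real.pi * T) ^ (3 / 2 : ℝ))⁻¹ * Real.exp (-‖z‖ ^ 2 / (4 * T)) *
        Φ (vecCons (X 0 - z) (vecTail X)) : ℝ) : ℂ) := by
  rw [integral_withDensity_gaussian, ← integral_complex_ofReal]
  refine integral_congr_ae (Eventually.of_forall fun z => ?_)
  dsimp only
  rw [← gaussKernel_eq_prod hT, vecCons_sub_vecTail]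
  push_cast
  ring

/-! ### Feynman–Kac domination and AM–GM -/

/-- **Feynman–Kac domination read on the torus ground state**: for a witness `Φ` of
`IsPeriodicGroundStateFK v L` and `t > 0`, `e^{-tE₀} Φ(X) ≤ |(e^{tΔ}Φ)(X)|` pointwise — the
eigen-relation `e^{-tH}Φ = e^{-tE₀}Φ`, the weights `e^{-∫v^per} ≤ 1` of the interacting functional
against the weight `1` of the free one, and finiteness of the free functional on periodic `L²(cell)`
data (`periodicFKSemigroup_lt_top_of_cell`). [folklore] -/
theorem exp_mul_le_norm_periodicHeatFlow_zero_pot {v : ℝ → ℝ≥0∞} (hL : 0 < L)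
    {Φ : Config N → ℝ} (hΦ : IsPeriodicGroundStateFK v L Φ) {t : ℝ} (ht : 0 < t) (X : Config N) :
    Real.exp (-((periodicGroundStateEnergy v N L).toReal * t)) * Φ X ≤
      ‖periodicHeatFlow 0 N L t (fun Y => (Φ Y : ℂ)) X‖ := by
  have hv0 : Measurable (0 : ℝ → ℝ≥0∞) := measurable_const
  have heq := periodicHeatFlow_ofReal_eq_periodicFKSemigroup hv0 L t hΦ.measurable hΦ.nonneg X
  have hdom : periodicFKSemigroup v L t (fun Y => ENNReal.ofReal (Φ Y)) X ≤
      periodicFKSemigroup 0 L t (fun Y => ENNReal.ofReal (Φ Y)) X := by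
    refine (periodicFKSemigroup_le_lintegral_worldLine v L t _ X).trans_eq ?_
    simp only [periodicFKSemigroup, periodicFKWeight_zero_pot, one_mul]
  have hper' : ∀ (Y : Config N) (i : Fin N) (k : Fin 3),
      ENNReal.ofReal (Φ (Y + Pi.single i (EuclideanSpace.single k L))) = ENNReal.ofReal (Φ Y) :=
    fun Y i k => by rw [hΦ.periodic]
  have h2' : ∫⁻ Y in cellN N L, ENNReal.ofReal (Φ Y) ^ (2 : ℝ) ≠ ⊤ := by
    simp_rw [ENNReal.rpow_two]; exact hΦ.setLIntegral_sq_ne_top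
  have hfin : periodicFKSemigroup 0 L t (fun Y => ENNReal.ofReal (Φ Y)) X ≠ ⊤ :=
    (periodicFKSemigroup_lt_top_of_cell 0 hL ht hΦ.measurable.ennreal_ofReal hper' h2' X).ne
  have heig := hΦ.eigen t ht.le X
  calc Real.exp (-((periodicGroundStateEnergy v N L).toReal * t)) * Φ X
      = (ENNReal.ofReal (Real.exp (-((periodicGroundStateEnergy v N L).toReal * t)) * Φ X)).toReal :=
        (ENNReal.toReal_ofReal (mul_nonneg (Real.exp_pos _).le (hΦ.nonneg X))).symm
    _ ≤ (periodicFKSemigroup 0 L t (fun Y => ENNReal.ofReal (Φ Y)) X).toReal :=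
        ENNReal.toReal_mono hfin (heig ▸ hdom)
    _ = (periodicHeatFlow 0 N L t (fun Y => (Φ Y : ℂ)) X).re := by rw [heq, Complex.ofReal_re]
    _ ≤ _ := Complex.re_le_norm _

/-- **AM–GM for exponentials** (Jensen for `exp` with equal weights on `N + 1` points):
`exp((N+1)⁻¹ ∑ⱼ xⱼ) ≤ (N+1)⁻¹ ∑ⱼ exp(xⱼ)`. [folklore] -/
theorem exp_avg_le_avg_exp (x : Fin (N + 1) → ℝ) :
    Real.exp (((N : ℝ) + 1)⁻¹ * ∑ j, x j) ≤ ((N : ℝ) + 1)⁻¹ * ∑ j, Real.exp (x j) := by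
  have hN : (0 : ℝ) < (N : ℝ) + 1 := by positivity
  have h := ConvexOn.map_sum_le convexOn_exp (t := Finset.univ) (w := fun _ : Fin (N + 1) => ((N : ℝ) + 1)⁻¹)
    (p := x) (fun _ _ => by positivity) (by
      rw [Finset.sum_const, Finset.card_univ, Fintype.card_fin, nsmul_eq_mul]
      push_cast; field_simp) (fun _ _ => Set.mem_univ _)
  simpa only [smul_eq_mul, ← Finset.mul_sum] using h

/-! ### The stub -/

/-- **Registered stub `stub_uvTransfer` of line `healing-scale-kac-insertion` — UV transfer (the
residue does not see the tagged ultraviolet).** For every measurable `v ≥ 0` (hard cores included),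
`L > 0`, and the `(N+1)`-body torus Feynman–Kac ground state `Φ₀ = periodicFKGroundState v (N+1) L`
(a witness of `IsPeriodicGroundStateFK v L`), the Gaussian smoothing `e^{TΔ₀}` in the TAGGED
coordinate only, at the healing time `T = (N+1)/(16 E₀(N+1,L))`, keeps at least `9/16` of the mass:
`B = ∫_{cell} (e^{TΔ₀}Φ₀)² ≥ 9/16`. Proof: for `T ≤ 0` the smoothing is the identity and `B = 1`
(`norm_eq`). For `T > 0`, in the plane waves of the cell (Parseval for `L²` data; if `e^{TΔ₀}Φ₀`
is not square integrable on the cell there is nothing to prove),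
`L^{-3(N+1)} B = ∑ₙ e^{-8π²T|n₀|²/L²} |ĉₙ(Φ₀)|²`; Bose symmetry makes the weight of every block
the same, and AM–GM (`exp` convex) gives `(N+1)⁻¹ ∑ⱼ e^{-8π²T|nⱼ|²/L²} ≥ e^{-8π²t|n|²/L²}` with
`t = T/(N+1)`, the multiplier of `‖e^{tΔ}Φ₀‖²_cell`; Feynman–Kac domination and the eigen-relation
give `|e^{tΔ}Φ₀| ≥ e^{-tE₀}Φ₀` pointwise, so `B ≥ ‖e^{tΔ}Φ₀‖²_cell ≥ e^{-2tE₀} = e^{-1/8} ≥ 7/8 ≥ 9/16`.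
[folklore] -/
theorem stub_uvTransfer (v : ℝ → ℝ≥0∞) (hv : Measurable v) (N : ℕ) (L : ℝ) (hL : 0 < L)
    (hΦ : IsPeriodicGroundStateFK v L (periodicFKGroundState v (N + 1) L)) :
    ENNReal.ofReal (9 / 16) ≤
      ∫⁻ X in cellN (N + 1) L, ENNReal.ofReal
        ((let T : ℝ := ((N : ℝ) + 1) / (16 * (periodicGroundStateEnergy v (N + 1) L).toReal)
          if T ≤ 0 then periodicFKGroundState v (N + 1) L X
          else ∫ z : Space, ((4 * Real.pi * T) ^ (3 / 2 : ℝ))⁻¹ * Real.exp (-‖z‖ ^ 2 / (4 * T)) *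
            periodicFKGroundState v (N + 1) L (vecCons (X 0 - z) (vecTail X))) ^ 2) := by
  have _hv := hv -- holds for every measurable `v`; `hv` belongs to the registered signature
  set Φ := periodicFKGroundState v (N + 1) L with hΦdef
  set E₀ := periodicGroundStateEnergy v (N + 1) L with hE₀
  set T : ℝ := ((N : ℝ) + 1) / (16 * E₀.toReal) with hT
  show ENNReal.ofReal (9 / 16) ≤ ∫⁻ X in cellN (N + 1) L, ENNReal.ofReal
        ((if T ≤ 0 then Φ X
          else ∫ z : Space, ((4 * Real.pi * T) ^ (3 / 2 : ℝ))⁻¹ * Real.exp (-‖z‖ ^ 2 / (4 * T)) *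
            Φ (vecCons (X 0 - z) (vecTail X))) ^ 2)
  have hnormsq : ∫⁻ X in cellN (N + 1) L, ENNReal.ofReal (Φ X ^ 2) = 1 := by
    rw [← hΦ.norm_eq]
    exact lintegral_congr fun X => ENNReal.ofReal_pow (hΦ.nonneg X) 2
  by_cases hT0 : T ≤ 0
  · simp only [if_pos hT0, hnormsq]
    exact ENNReal.ofReal_le_one.2 (by norm_num)
  simp only [if_neg hT0]
  rw [not_le] at hT0
  -- positivity of the energy and the times
  have hE : 0 < E₀.toReal := by
    by_contra h
    have h0 : E₀.toReal = 0 := le_antisymm (not_lt.1 h) ENNReal.toReal_nonneg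
    rw [hT, h0, mul_zero, div_zero] at hT0
    exact lt_irrefl _ hT0
  have hTn : T.toNNReal ≠ 0 := by simpa using hT0
  set t : ℝ := T / ((N : ℝ) + 1) with ht
  have hN1 : (0 : ℝ) < (N : ℝ) + 1 := by positivity
  have htpos : 0 < t := div_pos hT0 hN1
  have hEt : E₀.toReal * t = 1 / 16 := by
    rw [ht, hT]; field_simp
  -- the complexified ground state
  set Φc : Config (N + 1) → ℂ := fun X => (Φ X : ℂ) with hΦc
  have hΦcm : Measurable Φc := Complex.measurable_ofReal.comp hΦ.measurable
  have hΦcper : IsTorusPeriodic L Φc := fun X i k => by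
    simp only [hΦc, hΦ.periodic]
  have hΦcsymm : ∀ (σ : Equiv.Perm (Fin (N + 1))) (X : Config (N + 1)), Φc (X ∘ σ) = Φc X :=
    fun σ X => by simp only [hΦc, hΦ.symm]
  have hΦce : ∀ X, ‖Φc X‖ₑ = ENNReal.ofReal (Φ X) := fun X => by
    rw [hΦc]; dsimp only; rw [← ofReal_norm, Complex.norm_real, Real.norm_of_nonneg (hΦ.nonneg X)]
  have hΦc2 : ∫⁻ X in cellN (N + 1) L, ‖Φc X‖ₑ ^ 2 = 1 := by
    simp_rw [hΦce]; exact hΦ.norm_eq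
  have hΦc1 : ∫⁻ X in cellN (N + 1) L, ‖Φc X‖ₑ ≠ ⊤ := by
    refine ne_top_of_le_ne_top ?_ (setLIntegral_cellN_le_L2 L hΦcm.enorm.aemeasurable)
    simp_rw [ENNReal.rpow_two, hΦc2, ENNReal.one_rpow, mul_one]
    exact ENNReal.rpow_ne_top_of_nonneg (by norm_num) (volume_cellN_ne_top _ L)
  have hΦcL2 : MemLp Φc 2 (volume.restrict (cellN (N + 1) L)) :=
    memLp_two_of_lintegral_ne_top hΦcm.aestronglyMeasurable (by rw [hΦc2]; exact ENNReal.one_ne_top)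
  -- the free flow at time `t`
  have hv0 : Measurable (0 : ℝ → ℝ≥0∞) := measurable_const
  obtain ⟨ΨP, hΨP⟩ : ∃ f : Config (N + 1) → ℂ, f = periodicHeatFlow 0 (N + 1) L t Φc := ⟨_, rfl⟩
  have hPm : Measurable ΨP := hΨP ▸ measurable_periodicHeatFlow hv0 L t hΦcm
  have hP2 : ∫⁻ X in cellN (N + 1) L, ‖ΨP X‖ₑ ^ 2 ≤ 1 := by
    rw [← hΦc2, hΨP]
    exact setLIntegral_cellN_enorm_periodicHeatFlow_sq_le hv0 hL t hΦcm hΦcper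
  have hPL2 : MemLp ΨP 2 (volume.restrict (cellN (N + 1) L)) :=
    memLp_two_of_lintegral_ne_top hPm.aestronglyMeasurable
      (ne_top_of_le_ne_top ENNReal.one_ne_top hP2)
  have hPlow : ∀ X, Real.exp (-(E₀.toReal * t)) * Φ X ≤ ‖ΨP X‖ := fun X => by
    rw [hΨP]; exact exp_mul_le_norm_periodicHeatFlow_zero_pot hL hΦ htpos X
  have hPcoef : ∀ n, configFourierCoeff L ΨP n =
      ((Real.exp (-(4 * Real.pi ^ 2 * (L⁻¹) ^ 2 * t * ∑ p, ((n p : ℝ)) ^ 2)) : ℝ) : ℂ) *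
        configFourierCoeff L Φc n := fun n => by
    rw [hΨP]; exact configFourierCoeff_periodicHeatFlow_zero_pot hL hΦcm hΦcper hΦc1 htpos n
  -- the tagged smoothing at time `T`
  obtain ⟨ΨS, hΨS⟩ : ∃ f : Config (N + 1) → ℂ, f = fun X => ∫ z, Φc (X + Pi.single (0 : Fin (N + 1)) (-z))
      ∂(volume : Measure Space).withDensity
        (fun z : Space => ∏ k, gaussianPDF 0 (2 * T.toNNReal) (z k)) := ⟨_, rfl⟩
  have hSm : StronglyMeasurable ΨS := by
    haveI := isProbabilityMeasure_withDensity_gaussian hTn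
    rw [hΨS]
    exact stronglyMeasurable_integral_translate hΦcm _ measurable_single_zero_neg
  have hS_eq : ∀ X, ΨS X = ((∫ z : Space, ((4 * Real.pi * T) ^ (3 / 2 : ℝ))⁻¹ *
      Real.exp (-‖z‖ ^ 2 / (4 * T)) * Φ (vecCons (X 0 - z) (vecTail X)) : ℝ) : ℂ) := fun X => by
    rw [hΨS]; exact integral_gaussian_translate_eq_ofReal Φ hT0 X
  have hScoef : ∀ n, configFourierCoeff L ΨS n =
      ((Real.exp (-(4 * Real.pi ^ 2 * (L⁻¹) ^ 2 * T.toNNReal * ∑ k, ((n (0, k) : ℝ)) ^ 2)) : ℝ) : ℂ) *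
        configFourierCoeff L Φc n := fun n => by
    rw [hΨS]; exact configFourierCoeff_gaussian_single_zero hL hΦcm hΦcper hΦc1 hTn n
  -- rewrite the goal through `ΨS`
  have hgoal : ∀ X, ENNReal.ofReal ((∫ z : Space, ((4 * Real.pi * T) ^ (3 / 2 : ℝ))⁻¹ *
      Real.exp (-‖z‖ ^ 2 / (4 * T)) * Φ (vecCons (X 0 - z) (vecTail X))) ^ 2) = ‖ΨS X‖ₑ ^ 2 := by
    intro X
    rw [hS_eq, ← ofReal_norm, Complex.norm_real, Real.norm_eq_abs, ← ENNReal.ofReal_pow (abs_nonneg _),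
      sq_abs]
  simp_rw [hgoal]
  by_cases hStop : ∫⁻ X in cellN (N + 1) L, ‖ΨS X‖ₑ ^ 2 = ⊤
  · rw [hStop]; exact le_top
  have hSL2 : MemLp ΨS 2 (volume.restrict (cellN (N + 1) L)) :=
    memLp_two_of_lintegral_ne_top hSm.aestronglyMeasurable hStop
  rw [lintegral_enorm_sq_eq_ofReal hSL2]
  refine ENNReal.ofReal_le_ofReal ?_
  -- the Fourier side
  set c : ℝ := ((L ^ 3)⁻¹) ^ (N + 1) with hc
  have hcpos : 0 < c := by positivity
  set a : (Fin (N + 1) × Fin 3 → ℤ) → ℝ := fun n => ‖configFourierCoeff L Φc n‖ ^ 2 with ha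
  set θ : Fin (N + 1) → (Fin (N + 1) × Fin 3 → ℤ) → ℝ := fun j n =>
    Real.exp (-(8 * Real.pi ^ 2 * (L⁻¹) ^ 2 * T * ∑ k, ((n (j, k) : ℝ)) ^ 2)) with hθ
  set Θ : (Fin (N + 1) × Fin 3 → ℤ) → ℝ := fun n =>
    Real.exp (-(8 * Real.pi ^ 2 * (L⁻¹) ^ 2 * t * ∑ p, ((n p : ℝ)) ^ 2)) with hΘ
  have hTco : ((T.toNNReal : ℝ≥0) : ℝ) = T := Real.coe_toNNReal T hT0.le
  -- Parseval for the smoothing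
  have hS_sum : HasSum (fun n => θ 0 n * a n) (c * ∫ X in cellN (N + 1) L, ‖ΨS X‖ ^ 2) := by
    refine (hasSum_sq_configFourierCoeff_of_memLp hL hSL2).congr_fun fun n => ?_
    rw [hScoef n, norm_mul, mul_pow, Complex.norm_real, Real.norm_of_nonneg (Real.exp_pos _).le,
      ← Real.exp_nat_mul, hTco]
    simp only [hθ, ha]
    congr 2
    push_cast
    ring
  -- Parseval for the free flow
  have hP_sum : HasSum (fun n => Θ n * a n) (c * ∫ X in cellN (N + 1) L, ‖ΨP X‖ ^ 2) := by
    refine (hasSum_sq_configFourierCoeff_of_memLp hL hPL2).congr_fun fun n => ?_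
    rw [hPcoef n, norm_mul, mul_pow, Complex.norm_real, Real.norm_of_nonneg (Real.exp_pos _).le,
      ← Real.exp_nat_mul]
    simp only [hΘ, ha]
    congr 2
    push_cast
    ring
  -- Bose symmetry: every block carries the same weight
  have hS_sum_j : ∀ j : Fin (N + 1),
      HasSum (fun n => θ j n * a n) (c * ∫ X in cellN (N + 1) L, ‖ΨS X‖ ^ 2) := by
    intro j
    set σ : Equiv.Perm (Fin (N + 1)) := Equiv.swap 0 j with hσ
    set e : (Fin (N + 1) × Fin 3 → ℤ) ≃ (Fin (N + 1) × Fin 3 → ℤ) :=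
      { toFun := fun n p => n (σ p.1, p.2)
        invFun := fun n p => n (σ.symm p.1, p.2)
        left_inv := fun n => funext fun p => by simp
        right_inv := fun n => funext fun p => by simp } with he
    have h := (e.hasSum_iff (f := fun n => θ 0 n * a n)).2 hS_sum
    refine h.congr_fun fun n => ?_
    simp only [Function.comp_apply, he, hθ, ha, Equiv.coe_fn_mk, hσ, Equiv.swap_apply_left]
    rw [configFourierCoeff_perm hΦcsymm]
  -- average over the blocks and AM–GM
  have havg : HasSum (fun n => ((N : ℝ) + 1)⁻¹ * ∑ j, θ j n * a n)
      (c * ∫ X in cellN (N + 1) L, ‖ΨS X‖ ^ 2) := by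
    have h := (hasSum_sum fun j (_ : j ∈ Finset.univ) => hS_sum_j j).mul_left (((N : ℝ) + 1)⁻¹)
    rw [Finset.sum_const, Finset.card_univ, Fintype.card_fin, nsmul_eq_mul, Nat.cast_add,
      Nat.cast_one, ← mul_assoc, inv_mul_cancel₀ hN1.ne', one_mul] at h
    exact h
  have hcmp : ∀ n, Θ n * a n ≤ ((N : ℝ) + 1)⁻¹ * ∑ j, θ j n * a n := by
    intro n
    rw [← Finset.sum_mul, ← mul_assoc]
    refine mul_le_mul_of_nonneg_right ?_ (by positivity)
    have h := exp_avg_le_avg_exp (N := N)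
      (fun j => -(8 * Real.pi ^ 2 * (L⁻¹) ^ 2 * T * ∑ k, ((n (j, k) : ℝ)) ^ 2))
    refine le_trans (le_of_eq ?_) h
    simp only [hΘ]
    congr 1
    have hsum : ∑ j : Fin (N + 1), -(8 * Real.pi ^ 2 * (L⁻¹) ^ 2 * T * ∑ k, ((n (j, k) : ℝ)) ^ 2) =
        -(8 * Real.pi ^ 2 * (L⁻¹) ^ 2 * T) * ∑ j, ∑ k, ((n (j, k) : ℝ)) ^ 2 := by
      rw [Finset.mul_sum]
      exact Finset.sum_congr rfl fun j _ => by ring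
    rw [hsum, Fintype.sum_prod_type, ht]
    field_simp
  have hle : c * ∫ X in cellN (N + 1) L, ‖ΨP X‖ ^ 2 ≤ c * ∫ X in cellN (N + 1) L, ‖ΨS X‖ ^ 2 :=
    hasSum_le hcmp hP_sum havg
  -- the free flow keeps `e^{-1/8}` of the mass
  have hPmass : Real.exp (-(1 / 8)) ≤ ∫ X in cellN (N + 1) L, ‖ΨP X‖ ^ 2 := by
    have hΦ2int : Integrable (fun X => Φ X ^ 2) (volume.restrict (cellN (N + 1) L)) := by
      have h := (memLp_two_iff_integrable_sq_norm hΦcL2.1).1 hΦcL2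
      refine h.congr (Eventually.of_forall fun X => ?_)
      simp only [hΦc, Complex.norm_real, Real.norm_eq_abs, sq_abs]
    have hone : ∫ X in cellN (N + 1) L, Φ X ^ 2 = 1 := by
      rw [integral_eq_lintegral_of_nonneg_ae (Eventually.of_forall fun X => by positivity)
        hΦ2int.aestronglyMeasurable, hnormsq, ENNReal.toReal_one]
    calc Real.exp (-(1 / 8)) = Real.exp (-(E₀.toReal * t)) ^ 2 * ∫ X in cellN (N + 1) L, Φ X ^ 2 := by
          rw [hone, mul_one, ← Real.exp_nat_mul, hEt]; norm_num
      _ = ∫ X in cellN (N + 1) L, (Real.exp (-(E₀.toReal * t)) * Φ X) ^ 2 := by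
          rw [← integral_const_mul]
          exact integral_congr_ae (Eventually.of_forall fun X => by simp only [mul_pow])
      _ ≤ ∫ X in cellN (N + 1) L, ‖ΨP X‖ ^ 2 := by
          refine integral_mono_ae ((hΦ2int.const_mul (Real.exp (-(E₀.toReal * t)) ^ 2)).congr
            (Eventually.of_forall fun X => by simp only [mul_pow]))
            ((memLp_two_iff_integrable_sq_norm hPL2.1).1 hPL2)
            (Eventually.of_forall fun X => ?_)
          exact pow_le_pow_left₀ (mul_nonneg (Real.exp_pos _).le (hΦ.nonneg X)) (hPlow X) 2
  -- conclusion
  have h78 : (9 : ℝ) / 16 ≤ Real.exp (-(1 / 8)) := by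
    have := Real.add_one_le_exp (-(1 / 8 : ℝ))
    linarith
  have hfin : c * Real.exp (-(1 / 8)) ≤ c * ∫ X in cellN (N + 1) L, ‖ΨS X‖ ^ 2 :=
    (mul_le_mul_of_nonneg_left hPmass hcpos.le).trans hle
  exact h78.trans (le_of_mul_le_mul_left hfin hcpos)

end Summit.AtomisticToContinuum.BoseEinsteinCondensation.Theorems.CorrectorClosure.HealingScaleKacInsertion

end
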